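import Literature.Barriers.ValiantsHypothesis.BDGIL24WeightProjectionProofs
import Literature.Computability.AlgebraicComplexity.ArithCircuitVars
import Literature.Computability.AlgebraicComplexity.IMMInVPProofs
import HarnessLib

/-!
# "Both definitions give the same class VP": circuit size with affine-linear input gates (`cc`)
# vs. the tree's gate count `complexity` ([BDGIL24, §2.1]) — PROVED
# (`BergEtAl2024.complexity_le_of_affComplexity`, `BergEtAl2024.isPBounded_complexity_iff_affComplexity`)

[BDGIL24] = M. van den Berg, P. Dutta, F. Gesmundo, C. Ikenmeyer, V. Lysikov, *Algebraic
metacomplexity and representation theory*, arXiv:2411.03444, §2.1 (p.6, PDF p.7, p0007.txt:L17–L23):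

> "Recall that in the definition of algebraic circuits we allow affine linear forms at the input
> gates. We say that the complexity measure `cc` is an invariant complexity measure. In more
> restrictive circuit definitions, for instance if the input gates are required to be variables,
> the associated circuit complexity `c′` might change under the action of `GL_k`. However, both
> definitions give the same class VP."

In the tree, `cc` is `BergEtAl2024.affComplexity` (`BDGIL24IsotypicNaturalProofs.lean`: the least
`complexity` of a `G` with `F = G(ℓ₁, …, ℓ_m)`, `ℓ_i` affine) and `c′` is Bürgisser's gate count
`complexity` (`ArithCircuit.lean`; variables and constants are free operands). One inequality,
`cc(F) ≤ L(F)`, is `affComplexity_le_complexity` (statement file). This file proves the converse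
up to the cost of the input forms and the printed consequence:

* `complexity_le_of_totalDegree_le_one` — an affine-linear polynomial in `N` variables has
  `L ≤ 2N + 1`;
* **`complexity_le_of_affComplexity`** — `L(F) ≤ cc(F) + (2 cc(F) + 1)(2N + 1)`: an optimal
  presentation `F = G(ℓ)` can be taken with `G` in the `≤ 2 cc(F) + 1` variables it actually
  involves (`ArithCircuit.card_vars_le_two_mul_complexity_add_one`: a fan-in-two circuit of size
  `s` reads at most `2s + 1` variables; `MvPolynomial.exists_rename_eq_of_vars_subset_range`,
  `complexity_rename_of_injective`), and substitution costs `L(G) + Σ L(ℓ_i)`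
  (`complexity_aeval_le`, Bürgisser 2000 Rem. 2.7);
* **`isPBounded_complexity_iff_affComplexity`** — for a family `(F_n)` whose number of variables
  is p-bounded, `L(F_n)` is p-bounded iff `cc(F_n)` is: "both definitions give the same class VP".

No definitions, no named facts. Honest framing: model bookkeeping; nothing here bears on `VP ≠ VNP`.

## References
* [BergEtAl2024] arXiv:2411.03444, §2.1, p.6 (PDF p.7).
* [Burgisser2000] P. Bürgisser, *Completeness and Reduction in Algebraic Complexity Theory*,
  Def. 2.1, Rem. 2.7 (substitution).
-/

noncomputable section

open MvPolynomial
open scoped BigOperators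

namespace Literature.Barriers.ValiantsHypothesis

namespace BergEtAl2024

open Literature.Computability.AlgebraicComplexity

section Affine

variable {τ : Type*} [Fintype τ]

/-- An exponent vector of degree `≤ 1` is `0` or a unit vector. [folklore] -/
private theorem finsupp_eq_zero_or_single {s : τ →₀ ℕ} (h : s.degree ≤ 1) :
    s = 0 ∨ ∃ i, s = Finsupp.single i 1 := by
  classical
  by_cases hs : s = 0
  · exact Or.inl hs
  · right
    obtain ⟨i, hi⟩ : ∃ i, s i ≠ 0 := by
      by_contra hall
      push Not at hall
      exact hs (Finsupp.ext hall)
    refine ⟨i, Finsupp.ext fun j => ?_⟩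
    have hsum : s.degree = ∑ j ∈ s.support, s j := rfl
    have hi' : i ∈ s.support := Finsupp.mem_support_iff.2 hi
    have hle : s i ≤ s.degree := by
      rw [hsum]
      exact Finset.single_le_sum (fun _ _ => Nat.zero_le _) hi'
    have hsi : s i = 1 := by omega
    by_cases hji : j = i
    · subst hji
      rw [Finsupp.single_eq_same, hsi]
    · rw [Finsupp.single_apply, if_neg (Ne.symm hji)]
      by_contra hj
      have hj' : j ∈ s.support := Finsupp.mem_support_iff.2 hj
      have h2 : s i + s j ≤ s.degree := by
        rw [hsum, ← Finset.sum_pair (Ne.symm hji)]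
        exact Finset.sum_le_sum_of_subset (by
          intro x hx
          rcases Finset.mem_insert.1 hx with rfl | hx
          · exact hi'
          · rw [Finset.mem_singleton.1 hx]; exact hj')
      omega

/-- Affine expansion: a polynomial of total degree `≤ 1` is `C (coeff 0 p) + Σᵢ C (coeff eᵢ p) · Xᵢ`.
[folklore] -/
private theorem eq_C_add_sum_of_totalDegree_le_one' {p : MvPolynomial τ ℂ}
    (hp : p.totalDegree ≤ 1) :
    p = C (coeff 0 p) + ∑ i, C (coeff (Finsupp.single i 1) p) * X i := by
  classical
  ext s
  simp only [coeff_add, coeff_C, coeff_sum, coeff_C_mul, coeff_X]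
  by_cases hs0 : s = 0
  · subst hs0
    rw [if_pos rfl, Finset.sum_eq_zero (fun i _ => ?_), add_zero]
    rw [if_neg (Finsupp.single_ne_zero.mpr one_ne_zero), mul_zero]
  rw [if_neg (Ne.symm hs0), zero_add]
  by_cases hs1 : ∃ i, s = Finsupp.single i 1
  · obtain ⟨i, rfl⟩ := hs1
    rw [Finset.sum_eq_single i]
    · rw [if_pos rfl, mul_one]
    · intro j _ hji
      rw [if_neg (fun h => hji (Finsupp.single_left_injective one_ne_zero h)), mul_zero]
    · intro h; exact absurd (Finset.mem_univ i) h
  · have hl : coeff s p = 0 := by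
      by_contra h
      have hmem : s ∈ p.support := mem_support_iff.mpr h
      have hdeg : s.degree ≤ 1 := (le_totalDegree hmem).trans hp
      rcases finsupp_eq_zero_or_single hdeg with h | h
      · exact hs0 h
      · exact hs1 h
    rw [hl, eq_comm]
    refine Finset.sum_eq_zero fun i _ => ?_
    rw [if_neg (fun h => hs1 ⟨i, h.symm⟩), mul_zero]

/-- **An affine-linear polynomial in `N` variables has gate count `≤ 2N + 1`** (one product and
one sum gate per variable, plus the constant; variables and constants are free operands in
Bürgisser's model). [cite: BergEtAl2024, §2.1, p.6 (PDF p.7)] locator: paper:arxiv-2411.03444 p0007.txt:L19–L23 -/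
theorem complexity_le_of_totalDegree_le_one {ℓ : MvPolynomial τ ℂ} (hℓ : ℓ.totalDegree ≤ 1) :
    complexity ℓ ≤ 2 * Fintype.card τ + 1 := by
  classical
  rw [eq_C_add_sum_of_totalDegree_le_one' hℓ]
  have hterm : ∀ i : τ, complexity (C (coeff (Finsupp.single i 1) ℓ) * X i : MvPolynomial τ ℂ) ≤ 1 := by
    intro i
    refine (complexity_mul_le_holds _ _).trans ?_
    rw [complexity_C_holds, complexity_X_holds]
  have hsum : complexity (∑ i, C (coeff (Finsupp.single i 1) ℓ) * X i : MvPolynomial τ ℂ) ≤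
      2 * Fintype.card τ := by
    refine (complexity_finset_sum_le _ _).trans ?_
    rw [Finset.card_univ, two_mul]
    exact Nat.add_le_add_right ((Finset.sum_le_sum fun i _ => hterm i).trans (by simp)) _
  refine (complexity_add_le_holds _ _).trans ?_
  rw [complexity_C_holds]
  omega

/-- **`L(F) ≤ cc(F) + (2 cc(F) + 1)(2N + 1)`** for `F` in `N` variables: the gate count with
variables as inputs is bounded by the circuit size with affine-linear input gates plus the cost of
writing out the at most `2 cc(F) + 1` affine forms an optimal circuit reads
(`ArithCircuit.card_vars_le_two_mul_complexity_add_one`, `complexity_aeval_le`). The reverse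
inequality `cc(F) ≤ L(F)` is `affComplexity_le_complexity`.
[cite: BergEtAl2024, §2.1, p.6 (PDF p.7)] locator: paper:arxiv-2411.03444 p0007.txt:L19–L23 -/
theorem complexity_le_of_affComplexity (F : MvPolynomial τ ℂ) :
    complexity F ≤ affComplexity F + (2 * affComplexity F + 1) * (2 * Fintype.card τ + 1) := by
  classical
  obtain ⟨m, G, ℓ, hℓ, hGF, hc⟩ := exists_presentation_affComplexity F
  -- restrict `G` to the (at most `2 cc(F) + 1`) variables it involves
  obtain ⟨s, hsub, hscard⟩ :
      ∃ s : Finset (Fin m), G.vars ⊆ s ∧ s.card ≤ 2 * affComplexity F + 1 := by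
    refine ⟨G.vars, subset_rfl, ?_⟩
    rw [← hc]
    exact ArithCircuit.card_vars_le_two_mul_complexity_add_one G
  obtain ⟨G₀, rfl⟩ := exists_rename_eq_of_vars_subset_range G
    (Subtype.val : {i // i ∈ s} → Fin m) Subtype.val_injective (by
      intro i hi
      exact ⟨⟨i, hsub (Finset.mem_coe.1 hi)⟩, rfl⟩)
  have hcG₀ : complexity G₀ = affComplexity F := by
    rw [← hc, complexity_rename_of_injective_holds Subtype.val_injective]
  have hF : F = aeval (fun v : {i // i ∈ s} => ℓ v.1) G₀ := by
    rw [← hGF, aeval_rename]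
    rfl
  have hcard : Fintype.card {i // i ∈ s} ≤ 2 * affComplexity F + 1 := by
    rw [Fintype.card_coe]
    exact hscard
  calc complexity F = complexity (aeval (fun v : {i // i ∈ s} => ℓ v.1) G₀) := by rw [← hF]
    _ ≤ complexity G₀ + ∑ v : {i // i ∈ s}, complexity (ℓ v.1) := complexity_aeval_le _ _
    _ ≤ affComplexity F + ∑ _v : {i // i ∈ s}, (2 * Fintype.card τ + 1) := by
        rw [hcG₀]
        exact Nat.add_le_add_left (Finset.sum_le_sum fun v _ =>
          complexity_le_of_totalDegree_le_one (hℓ v.1)) _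
    _ = affComplexity F + Fintype.card {i // i ∈ s} * (2 * Fintype.card τ + 1) := by
        rw [Finset.sum_const, Finset.card_univ, smul_eq_mul]
    _ ≤ affComplexity F + (2 * affComplexity F + 1) * (2 * Fintype.card τ + 1) :=
        Nat.add_le_add_left (Nat.mul_le_mul_right _ hcard) _

end Affine

/-- **"Both definitions give the same class VP"** ([BDGIL24, §2.1]): for a family `(F_n)` of
polynomials whose number of variables is p-bounded in `n`, the gate count with variables as input
gates (`complexity`, Bürgisser) is p-bounded iff the circuit size with affine-linear input gates
(`cc = affComplexity`) is. (`⇐`: `complexity_le_of_affComplexity` and closure of p-bounded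
functions under `+`, `*`; `⇒`: `affComplexity_le_complexity`.)
[cite: BergEtAl2024, §2.1, p.6 (PDF p.7)] locator: paper:arxiv-2411.03444 p0007.txt:L21–L23 -/
theorem isPBounded_complexity_iff_affComplexity {τ : ℕ → Type*} [∀ n, Fintype (τ n)]
    (hτ : IsPBounded fun n => Fintype.card (τ n)) (F : (n : ℕ) → MvPolynomial (τ n) ℂ) :
    IsPBounded (fun n => complexity (F n)) ↔ IsPBounded (fun n => affComplexity (F n)) := by
  constructor
  · intro h
    exact h.mono fun n => affComplexity_le_complexity (F n)
  · intro h
    have h1 : IsPBounded fun n => 2 * affComplexity (F n) + 1 :=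
      IsPBounded.add_holds (IsPBounded.mul_holds (IsPBounded.const 2) h) (IsPBounded.const 1)
    have h2 : IsPBounded fun n => 2 * Fintype.card (τ n) + 1 :=
      IsPBounded.add_holds (IsPBounded.mul_holds (IsPBounded.const 2) hτ) (IsPBounded.const 1)
    have h3 : IsPBounded fun n =>
        affComplexity (F n) + (2 * affComplexity (F n) + 1) * (2 * Fintype.card (τ n) + 1) :=
      IsPBounded.add_holds h (IsPBounded.mul_holds h1 h2)
    exact h3.mono fun n => complexity_le_of_affComplexity (F n)

end BergEtAl2024

end Literature.Barriers.ValiantsHypothesis
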